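import Summits.BirchSwinnertonDyer.BirchSwinnertonDyer.Theorems.ResidualThetaTransportAtTwoSignedMuSeedAtTwoPlusGrasLambdaFiniteIndex

/-!
# The layer-rank certificate for cyclic `Λ′`-modules: `d_n < q^{p^n}` at ONE layer forces `μ = 0`

Route `ResidualThetaTransportAtTwo`, seed crux `SignedMuSeedAtTwoPlus` (stmt-BirchSwinnertonDyer-21438). The lead's
ε/`d_n`-test on the one undecided census field (`EPS-CERT-406203s1.md`, kit j311633/j311634; census
`IDEATION-CENSUS-k2g14.md` W8: «`A_n = X/ω_n X`, `X` cyclic since `d₀ = 1`, so `d_n = min(a, 2^n)` with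
`X/2X ≅ Ω/T^a`: `d_4 < 16 ⇒ μ = 0`») rests on the following piece of `Λ`-algebra, proved here in the kernel for
`Λ′ = 𝒪⟦X⟧` over any commutative coefficient ring `𝒪` with a distinguished element `ϖ ∣ p`:

* `omega_sub_X_pow_mem_span_C` — the Frobenius congruence `ω_n := (1+X)^{p^n} − 1 ≡ X^{p^n} (mod p)`;
* `sup_span_omega_eq_sup_span_X_pow` — hence `𝔞 + (ω_n) = 𝔞 + (X^{p^n})` for every ideal `𝔞 ∋ C p`;
* `card_quotient_span_C_sup_span_X_pow` — `#(𝒪⟦X⟧/(C ϖ, X^m)) = #(𝒪/ϖ)^m` (coefficients below degree `m`);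
* **`card_layerQuotient_of_le_span_C`** — for a CYCLIC module `X = Λ′/J` with `J ≤ (ϖ)` (i.e. «`μ ≥ 1`»):
  `#(Λ′/(J + (ϖ) + (ω_n))) = #(𝒪/ϖ)^{p^n}` at EVERY layer `n`; contrapositively
  **`not_le_span_C_of_card_layerQuotient_lt`**: if at ONE layer the `ϖ`-rank quotient `X/(ϖ, ω_n)X` is smaller
  than `q^{p^n}`, then `J ⊄ (ϖ)`, and then (`finite_quotient_sup_span_C_of_not_le`, `𝒪` a local PID with
  `𝔪 = (ϖ)` and finite residue field) `X/ϖX = Λ′/(J + (ϖ))` is FINITE — «`μ(X) = 0`».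

For the census field: `𝒪 = ℤ₂`, `ϖ = p = 2`, `X = X(L_∞/L)` cyclic (one ramified prime, `d₀ = 1`),
`A_n/2A_n = X/(2, ω_n)X`; `d_4 < 16` certifies `μ = 0`. The arithmetic identifications (`A_n ≅ X/ω_nX`, Lang
*Cyclotomic Fields* Ch. 5 Thm 4.1) are NOT formalised here. Nothing here proves BSD, the crux or (F). [folklore]
-/

set_option autoImplicit false
set_option linter.dupNamespace false

namespace Summit.BirchSwinnertonDyer.BirchSwinnertonDyer.Theorems.SignedMuAtTwo.GrasLeopoldt

open PowerSeries IsLocalRing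

section AnyRing

variable {𝒪 : Type*} [CommRing 𝒪]

/-- **Frobenius congruence for `ω_n`.** In `𝒪⟦X⟧`, for a prime `p`:
`(1 + X)^{p^n} − 1 − X^{p^n} ∈ (C p)` — the middle binomial coefficients `C(p^n, k)`, `0 < k < p^n`, are
divisible by `p`. [folklore] -/
theorem omega_sub_X_pow_mem_span_C (p : ℕ) (hp : p.Prime) (n : ℕ) :
    ((1 + X : 𝒪⟦X⟧) ^ (p ^ n) - 1) - X ^ (p ^ n) ∈ Ideal.span {(C (p : 𝒪) : 𝒪⟦X⟧)} := by
  obtain ⟨N, hN⟩ : ∃ N : ℕ, p ^ n = N + 1 := ⟨p ^ n - 1, (Nat.succ_pred_eq_of_pos (pow_pos hp.pos n)).symm⟩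
  rw [hN, add_comm (1 : 𝒪⟦X⟧) X, add_pow, Finset.sum_range_succ, Finset.sum_range_succ']
  simp only [one_pow, mul_one, pow_zero, Nat.choose_zero_right, Nat.cast_one, Nat.choose_self]
  have : ((∑ k ∈ Finset.range N, (X : 𝒪⟦X⟧) ^ (k + 1) * ((N + 1).choose (k + 1) : 𝒪⟦X⟧)) + 1 +
      X ^ (N + 1) - 1 - X ^ (N + 1)) =
      ∑ k ∈ Finset.range N, (X : 𝒪⟦X⟧) ^ (k + 1) * ((N + 1).choose (k + 1) : 𝒪⟦X⟧) := by ring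
  rw [this]
  refine Ideal.sum_mem _ fun k hk => Ideal.mul_mem_left _ _ ?_
  have hk' : k < N := Finset.mem_range.mp hk
  have hdvd : p ∣ (N + 1).choose (k + 1) := by
    rw [← hN]
    exact hp.dvd_choose_pow (Nat.succ_ne_zero k) (by omega)
  obtain ⟨c, hc⟩ := hdvd
  refine Ideal.mem_span_singleton.mpr ⟨(c : 𝒪⟦X⟧), ?_⟩
  rw [hc, Nat.cast_mul, map_natCast]

/-- **`𝔞 + (ω_n) = 𝔞 + (X^{p^n})`** for every ideal `𝔞` of `𝒪⟦X⟧` containing `C p`. [folklore] -/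
theorem sup_span_omega_eq_sup_span_X_pow (p : ℕ) (hp : p.Prime) (n : ℕ) (𝔞 : Ideal 𝒪⟦X⟧)
    (h𝔞 : (C (p : 𝒪) : 𝒪⟦X⟧) ∈ 𝔞) :
    𝔞 ⊔ Ideal.span {(1 + X : 𝒪⟦X⟧) ^ (p ^ n) - 1} = 𝔞 ⊔ Ideal.span {(X : 𝒪⟦X⟧) ^ (p ^ n)} := by
  have hmem : ((1 + X : 𝒪⟦X⟧) ^ (p ^ n) - 1) - X ^ (p ^ n) ∈ 𝔞 :=
    (Ideal.span_singleton_le_iff_mem _).mpr h𝔞 (omega_sub_X_pow_mem_span_C p hp n)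
  apply le_antisymm
  · refine sup_le le_sup_left ((Ideal.span_singleton_le_iff_mem _).mpr ?_)
    have : (1 + X : 𝒪⟦X⟧) ^ (p ^ n) - 1 =
        (((1 + X : 𝒪⟦X⟧) ^ (p ^ n) - 1) - X ^ (p ^ n)) + X ^ (p ^ n) := by ring
    rw [this]
    exact Submodule.add_mem_sup hmem (Ideal.mem_span_singleton_self _)
  · refine sup_le le_sup_left ((Ideal.span_singleton_le_iff_mem _).mpr ?_)
    have : (X : 𝒪⟦X⟧) ^ (p ^ n) =
        -(((1 + X : 𝒪⟦X⟧) ^ (p ^ n) - 1) - X ^ (p ^ n)) + ((1 + X : 𝒪⟦X⟧) ^ (p ^ n) - 1) := by ring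
    rw [this]
    exact Submodule.add_mem_sup (𝔞.neg_mem hmem) (Ideal.mem_span_singleton_self _)

end AnyRing

section Card

variable {𝒪 : Type*} [CommRing 𝒪]

/-- Coefficient extraction below degree `m`, modulo `ϖ`: the `𝒪`-linear map
`f ↦ (coeff i f mod ϖ)_{i<m}` is surjective. [folklore] -/
theorem coeffMod_surjective (ϖ : 𝒪) (m : ℕ) :
    Function.Surjective (fun f : 𝒪⟦X⟧ => fun i : Fin m =>
      Ideal.Quotient.mk (Ideal.span {ϖ}) (coeff (i : ℕ) f)) := by
  intro g
  choose lift hlift using fun i : Fin m => Ideal.Quotient.mk_surjective (g i)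
  refine ⟨PowerSeries.mk fun i => if h : i < m then lift ⟨i, h⟩ else 0, funext fun i => ?_⟩
  simp only [coeff_mk, dif_pos i.2, Fin.eta, hlift]

/-- The kernel of coefficient extraction below degree `m` modulo `ϖ` is `(C ϖ) + (X^m)`:
a series whose first `m` coefficients are divisible by `ϖ` is `C ϖ · a + X^m · b`. [folklore] -/
theorem mem_span_C_sup_span_X_pow_iff (ϖ : 𝒪) (m : ℕ) (f : 𝒪⟦X⟧) :
    f ∈ Ideal.span {(C ϖ : 𝒪⟦X⟧)} ⊔ Ideal.span {(X : 𝒪⟦X⟧) ^ m} ↔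
      ∀ i : ℕ, i < m → coeff i f ∈ Ideal.span {ϖ} := by
  constructor
  · intro hf i hi
    obtain ⟨a, b, hb, rfl⟩ := Ideal.mem_span_singleton_sup.mp hf
    obtain ⟨c, rfl⟩ := Ideal.mem_span_singleton.mp hb
    rw [map_add, mul_comm a, coeff_C_mul, coeff_X_pow_mul', if_neg (not_le.mpr hi), add_zero]
    exact Ideal.mem_span_singleton.mpr (dvd_mul_right ϖ _)
  · intro hf
    choose a ha using fun i : Fin m => Ideal.mem_span_singleton.mp (hf i i.2)
    -- `g` collects the quotients `coeff i f / ϖ` for `i < m`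
    let g : 𝒪⟦X⟧ := PowerSeries.mk fun i => if h : i < m then a ⟨i, h⟩ else 0
    have hrest : (X : 𝒪⟦X⟧) ^ m ∣ f - C ϖ * g := by
      rw [X_pow_dvd_iff]
      intro i hi
      rw [map_sub, coeff_C_mul, coeff_mk, dif_pos hi, ← ha ⟨i, hi⟩, sub_self]
    obtain ⟨b, hb⟩ := hrest
    refine Ideal.mem_span_singleton_sup.mpr ⟨g, X ^ m * b, Ideal.mem_span_singleton.mpr (dvd_mul_right _ _), ?_⟩
    rw [← hb, mul_comm g]
    ring

/-- **`#(𝒪⟦X⟧ / (C ϖ, X^m)) = #(𝒪/ϖ)^m`.** The quotient is identified (as an `𝒪`-module) with the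
coefficient vectors of length `m` modulo `ϖ`. [folklore] -/
theorem card_quotient_span_C_sup_span_X_pow (ϖ : 𝒪) (m : ℕ) :
    Nat.card (𝒪⟦X⟧ ⧸ (Ideal.span {(C ϖ : 𝒪⟦X⟧)} ⊔ Ideal.span {(X : 𝒪⟦X⟧) ^ m})) =
      Nat.card (𝒪 ⧸ Ideal.span {ϖ}) ^ m := by
  classical
  set 𝔟 : Ideal 𝒪⟦X⟧ := Ideal.span {(C ϖ : 𝒪⟦X⟧)} ⊔ Ideal.span {(X : 𝒪⟦X⟧) ^ m} with h𝔟
  -- the `𝒪`-linear coefficient map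
  let φ : 𝒪⟦X⟧ →ₗ[𝒪] (Fin m → 𝒪 ⧸ Ideal.span {ϖ}) :=
    { toFun := fun f i => Ideal.Quotient.mk (Ideal.span {ϖ}) (coeff (i : ℕ) f)
      map_add' := fun f g => funext fun i => by simp
      map_smul' := fun r f => funext fun i => by simp [Algebra.smul_def] }
  have hφsurj : Function.Surjective φ := coeffMod_surjective ϖ m
  have hker : LinearMap.ker φ = 𝔟.restrictScalars 𝒪 := by
    ext f
    rw [LinearMap.mem_ker, Submodule.restrictScalars_mem, h𝔟, mem_span_C_sup_span_X_pow_iff]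
    constructor
    · intro h i hi
      have := congrFun h ⟨i, hi⟩
      exact Ideal.Quotient.eq_zero_iff_mem.mp this
    · intro h
      funext i
      exact Ideal.Quotient.eq_zero_iff_mem.mpr (h i i.2)
  have e1 : (𝒪⟦X⟧ ⧸ LinearMap.ker φ) ≃ₗ[𝒪] (Fin m → 𝒪 ⧸ Ideal.span {ϖ}) :=
    φ.quotKerEquivRange.trans (LinearEquiv.ofTop _ (LinearMap.range_eq_top.mpr hφsurj))
  have e2 : (𝒪⟦X⟧ ⧸ 𝔟.restrictScalars 𝒪) ≃ₗ[𝒪] 𝒪⟦X⟧ ⧸ 𝔟 :=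
    Submodule.Quotient.restrictScalarsEquiv 𝒪 𝔟
  have e3 : (𝒪⟦X⟧ ⧸ LinearMap.ker φ) ≃ₗ[𝒪] (𝒪⟦X⟧ ⧸ 𝔟.restrictScalars 𝒪) :=
    Submodule.quotEquivOfEq _ _ hker
  have e : (𝒪⟦X⟧ ⧸ 𝔟) ≃ (Fin m → 𝒪 ⧸ Ideal.span {ϖ}) := (e2.symm.trans (e3.symm.trans e1)).toEquiv
  rw [Nat.card_congr e, Nat.card_fun, Nat.card_eq_fintype_card (α := Fin m), Fintype.card_fin]

end Card

section Certificate

variable {𝒪 : Type*} [CommRing 𝒪]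

/-- **The layer quotient of a cyclic module with `μ ≥ 1` has full size.** For `J ≤ (C ϖ)` with `ϖ ∣ p`:
`#(𝒪⟦X⟧ / (J + (C ϖ) + (ω_n))) = #(𝒪/ϖ)^{p^n}` at every layer `n` (`ω_n = (1+X)^{p^n} − 1`). [folklore] -/
theorem card_layerQuotient_of_le_span_C (ϖ : 𝒪) (p : ℕ) (hp : p.Prime) (hϖp : ϖ ∣ (p : 𝒪))
    (J : Ideal 𝒪⟦X⟧) (hJ : J ≤ Ideal.span {(C ϖ : 𝒪⟦X⟧)}) (n : ℕ) :
    Nat.card (𝒪⟦X⟧ ⧸ (J ⊔ Ideal.span {(C ϖ : 𝒪⟦X⟧)} ⊔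
        Ideal.span {(1 + X : 𝒪⟦X⟧) ^ (p ^ n) - 1})) =
      Nat.card (𝒪 ⧸ Ideal.span {ϖ}) ^ (p ^ n) := by
  have h1 : J ⊔ Ideal.span {(C ϖ : 𝒪⟦X⟧)} = Ideal.span {(C ϖ : 𝒪⟦X⟧)} := sup_eq_right.mpr hJ
  have hCp : (C (p : 𝒪) : 𝒪⟦X⟧) ∈ Ideal.span {(C ϖ : 𝒪⟦X⟧)} :=
    Ideal.mem_span_singleton.mpr (map_dvd C hϖp)
  rw [h1, sup_span_omega_eq_sup_span_X_pow p hp n _ hCp, card_quotient_span_C_sup_span_X_pow]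

/-- **The layer-rank certificate (contrapositive form).** If at ONE layer `n` the layer quotient
`X/(ϖ, ω_n)X = 𝒪⟦X⟧/(J + (C ϖ) + (ω_n))` of the cyclic module `X = 𝒪⟦X⟧/J` has FEWER than `#(𝒪/ϖ)^{p^n}`
elements (for `𝒪 = ℤ_p`: `d_n < p^n`), then `J ⊄ (C ϖ)`. [folklore] -/
theorem not_le_span_C_of_card_layerQuotient_lt (ϖ : 𝒪) (p : ℕ) (hp : p.Prime) (hϖp : ϖ ∣ (p : 𝒪))
    (J : Ideal 𝒪⟦X⟧) (n : ℕ)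
    (hlt : Nat.card (𝒪⟦X⟧ ⧸ (J ⊔ Ideal.span {(C ϖ : 𝒪⟦X⟧)} ⊔
        Ideal.span {(1 + X : 𝒪⟦X⟧) ^ (p ^ n) - 1})) < Nat.card (𝒪 ⧸ Ideal.span {ϖ}) ^ (p ^ n)) :
    ¬ J ≤ Ideal.span {(C ϖ : 𝒪⟦X⟧)} := fun hJ =>
  (ne_of_lt hlt) (card_layerQuotient_of_le_span_C ϖ p hp hϖp J hJ n)

end Certificate

section MuZero

variable {𝒪 : Type*} [CommRing 𝒪]

/-- **`(C ϖ)` is the kernel of reduction modulo `ϖ`**: `𝒪⟦X⟧ → (𝒪/ϖ)⟦X⟧`. [folklore] -/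
theorem ker_map_quotient_mk_eq_span_C (ϖ : 𝒪) :
    RingHom.ker (PowerSeries.map (Ideal.Quotient.mk (Ideal.span {ϖ}))) =
      Ideal.span {(C ϖ : 𝒪⟦X⟧)} := by
  ext f
  rw [RingHom.mem_ker, Ideal.mem_span_singleton]
  constructor
  · intro hf
    have hc : ∀ i, ϖ ∣ coeff i f := fun i => by
      have := (PowerSeries.ext_iff.mp hf) i
      rw [coeff_map, map_zero, Ideal.Quotient.eq_zero_iff_mem, Ideal.mem_span_singleton] at this
      exact this
    choose a ha using hc
    exact ⟨PowerSeries.mk a, by ext i; rw [coeff_C_mul, coeff_mk, ha]⟩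
  · rintro ⟨g, rfl⟩
    rw [map_mul, PowerSeries.map_C,
      Ideal.Quotient.eq_zero_iff_mem.mpr (Ideal.mem_span_singleton_self ϖ), map_zero, zero_mul]

/-- **`(C ϖ)` is prime in `𝒪⟦X⟧` when `(ϖ)` is prime in `𝒪`** (`𝒪⟦X⟧/(C ϖ) ≅ (𝒪/ϖ)⟦X⟧` is a domain).
[folklore] -/
theorem span_C_isPrime (ϖ : 𝒪) (hϖ : (Ideal.span {ϖ}).IsPrime) :
    (Ideal.span {(C ϖ : 𝒪⟦X⟧)}).IsPrime := by
  haveI : IsDomain (𝒪 ⧸ Ideal.span {ϖ}) := Ideal.Quotient.isDomain _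
  rw [← ker_map_quotient_mk_eq_span_C]
  exact RingHom.ker_isPrime _

variable [IsDomain 𝒪] [IsPrincipalIdealRing 𝒪] [IsLocalRing 𝒪]

/-- **`J ⊄ (C ϖ)` ⟹ `X/ϖX = 𝒪⟦X⟧/(J + (C ϖ))` is FINITE** («`μ(X) = 0`» for the cyclic module `X = 𝒪⟦X⟧/J`),
for `𝒪` a local PID with finite residue field and `ϖ ≠ 0` generating a prime ideal: `J + (C ϖ)` is gcd-free
(a common divisor divides the prime `C ϖ`, and is not associated to it since `C ϖ` does not divide all of
`J`), so `finite_quotient_of_gcdFree` applies. [folklore] -/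
theorem finite_quotient_sup_span_C_of_not_le [Finite (ResidueField 𝒪)] (ϖ : 𝒪) (hϖ0 : ϖ ≠ 0)
    (hϖ : (Ideal.span {ϖ}).IsPrime) (J : Ideal 𝒪⟦X⟧) (hJ : ¬ J ≤ Ideal.span {(C ϖ : 𝒪⟦X⟧)}) :
    Finite (𝒪⟦X⟧ ⧸ (J ⊔ Ideal.span {(C ϖ : 𝒪⟦X⟧)})) := by
  refine finite_quotient_of_gcdFree _ fun q hq => ?_
  have hC0 : (C ϖ : 𝒪⟦X⟧) ≠ 0 := fun h => hϖ0 (by simpa using congrArg constantCoeff h)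
  have hprime : Prime (C ϖ : 𝒪⟦X⟧) :=
    (Ideal.span_singleton_prime hC0).mp (span_C_isPrime ϖ hϖ)
  have hqC : q ∣ (C ϖ : 𝒪⟦X⟧) :=
    hq _ (Ideal.mem_sup_right (Ideal.mem_span_singleton_self _))
  rcases hprime.irreducible.dvd_iff.mp hqC with hu | hassoc
  · exact hu
  · exfalso
    apply hJ
    intro j hj
    exact Ideal.mem_span_singleton.mpr
      (hassoc.dvd_iff_dvd_left.mpr (hq j (Ideal.mem_sup_left hj)))

/-- **The layer-rank certificate for `μ = 0` (assembled).** `𝒪` a local PID with finite residue field,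
`ϖ ≠ 0` generating a prime ideal with `ϖ ∣ p` (`𝒪 = ℤ_p`, `ϖ = p`; `𝒪 = ℤ₂[ζ₃]`, `ϖ = 2`), `X = 𝒪⟦X⟧/J` a
CYCLIC module. If at ONE layer `n` the quotient `X/(ϖ, ω_n)X` has fewer than `#(𝒪/ϖ)^{p^n}` elements, then
`X/ϖX` is finite — «`μ(X) = 0`». For the census field of the lead's ε-test: `d_4 < 16 ⇒ μ₂ = 0`. [folklore] -/
theorem finite_quotient_sup_span_C_of_card_layerQuotient_lt [Finite (ResidueField 𝒪)] (ϖ : 𝒪)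
    (hϖ0 : ϖ ≠ 0) (hϖ : (Ideal.span {ϖ}).IsPrime) (p : ℕ) (hp : p.Prime) (hϖp : ϖ ∣ (p : 𝒪))
    (J : Ideal 𝒪⟦X⟧) (n : ℕ)
    (hlt : Nat.card (𝒪⟦X⟧ ⧸ (J ⊔ Ideal.span {(C ϖ : 𝒪⟦X⟧)} ⊔
        Ideal.span {(1 + X : 𝒪⟦X⟧) ^ (p ^ n) - 1})) < Nat.card (𝒪 ⧸ Ideal.span {ϖ}) ^ (p ^ n)) :
    Finite (𝒪⟦X⟧ ⧸ (J ⊔ Ideal.span {(C ϖ : 𝒪⟦X⟧)})) :=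
  finite_quotient_sup_span_C_of_not_le ϖ hϖ0 hϖ J
    (not_le_span_C_of_card_layerQuotient_lt ϖ p hp hϖp J n hlt)

end MuZero

end Summit.BirchSwinnertonDyer.BirchSwinnertonDyer.Theorems.SignedMuAtTwo.GrasLeopoldt
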